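import Literature.Combinatorics.Designs.SequenceSumSquares

/-!
# Hadamard 668 census — the sum-of-squares grammar of the T-sequence family at `v = 167`, in the kernel

Framing: lottery ticket; floor = certified bounds/negative ranges.

Cell pub-namedobj (venture DiscreteObjects), target (H).  Companion of `TurynTypeFamily668.lean`: the first necessary
conditions any search in this family enforces (Seberry–Yamada 2020 Lemma 1.19; Best–Đoković–Kharaghani–Ramp 2013 eq. (1)
at `x = 1`), specialised from `Literature/Combinatorics/Designs/SequenceSumSquares.lean` to the census parameters:
* `turynType56_sum_sq` — Turyn-type sequences `TT(56)` have element sums with `x² + y² + 2z² + 2w² = 334`;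
* `baseSeq167_sum_sq` — base sequences `BS(m, m, n, n)` with `m + n = 167` have `a² + b² + c² + d² = 334`
  (in particular `BS(84, 84, 83, 83)`);
* `tSeq167_sum_sq` — T-sequences of length `167` have `t₁² + t₂² + t₃² + t₄² = 167`.
Typed grammar only (constraints on hypothetical objects); nothing is asserted to exist; HITS 0.  No `sorry`.
-/

open Finset BigOperators

namespace Summit.Ventures.DiscreteObjects.Hadamard

open Literature.Combinatorics.Designs.TSequences
open Literature.Combinatorics.Designs.BaseSequences
open Literature.Combinatorics.Designs.SequenceSums

/-- **TT(56): `x² + y² + 2z² + 2w² = 334`** for the element sums of the four sequences (lengths 56, 56, 56, 55). -/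
theorem turynType56_sum_sq {x y z w : ℕ → ℤ} (h : IsTurynType 56 x y z w) :
    (∑ i ∈ range 56, x i) ^ 2 + (∑ i ∈ range 56, y i) ^ 2 + 2 * (∑ i ∈ range 56, z i) ^ 2 +
      2 * (∑ i ∈ range 55, w i) ^ 2 = 334 := by
  have := turynType_sum_sq h (by norm_num)
  norm_num at this
  exact this

/-- **BS(m, m, n, n), m + n = 167: `a² + b² + c² + d² = 334`** for the element sums. -/
theorem baseSeq167_sum_sq {m n : ℕ} {a b c d : ℕ → ℤ} (h : IsBaseSeq m n a b c d) (hmn : m + n = 167) :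
    (∑ i ∈ range m, a i) ^ 2 + (∑ i ∈ range m, b i) ^ 2 + (∑ i ∈ range n, c i) ^ 2 + (∑ i ∈ range n, d i) ^ 2 = 334 := by
  have e := baseSeq_sum_sq h
  have hc : ((m : ℤ) + n) = 167 := by exact_mod_cast hmn
  rw [hc] at e
  norm_num at e
  exact e

/-- in particular **BS(84, 84, 83, 83): `a² + b² + c² + d² = 334`**. -/
theorem baseSeq_84_83_sum_sq {a b c d : ℕ → ℤ} (h : IsBaseSeq 84 83 a b c d) :
    (∑ i ∈ range 84, a i) ^ 2 + (∑ i ∈ range 84, b i) ^ 2 + (∑ i ∈ range 83, c i) ^ 2 + (∑ i ∈ range 83, d i) ^ 2 = 334 :=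
  baseSeq167_sum_sq h rfl

/-- **T-sequences of length 167: `t₁² + t₂² + t₃² + t₄² = 167`** for the element sums. -/
theorem tSeq167_sum_sq {t : Fin 4 → ℕ → ℤ} (ht : IsTSeq 167 t) : ∑ k, (∑ i ∈ range 167, t k i) ^ 2 = 167 := by
  have := tseq_sum_sq ht
  exact_mod_cast this

end Summit.Ventures.DiscreteObjects.Hadamard
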